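import Summits.BirchSwinnertonDyer.BirchSwinnertonDyer.Theorems.BiquadraticEisensteinDescentManinDatumSupercuspidalCMInertResolventCertificateJZero
import HarnessLib

set_option linter.dupNamespace false -- `Summit.BirchSwinnertonDyer.BirchSwinnertonDyer.Theorems.…` (summit = sub, D-0017)
set_option autoImplicit false

/-!
# Crux `ManinDatumSupercuspidalCMInert` (stmt-BirchSwinnertonDyer-20111, BED r605), stub `stub_S5` (`j = 0` at `p = 5`) — the character
# axioms of the CM core from MULTIPLICATIVITY: `core_rho_of_mulChar`

Route `BiquadraticEisensteinDescent` (cell `pub/bsd-wall`, width seat `bsd-wall-cm-bed-w1` g8; `--supports` stmt-BirchSwinnertonDyer-20111,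
helper). THEOREMS ONLY (no definition, no named fact, no `sorry`); nothing here proves the stub, the crux, Manin's conjecture or BSD.

The CM core `…ResolventCertificateJZero.core_rho_of_character` takes a weight `Φ : (ℤ/5)² → ℂ` with five axioms phrased in the
coordinates `d ↔ d₁ρ + d₂` of `𝔽₂₅ = 𝔽₅[ρ]`. The weight the E-side supplies is (a power of) a sextic residue character modulo the inert
prime `5` of `ℤ[ρ]`, i.e. a MULTIPLICATIVE function on `𝔽₂₅`. This file reduces the five axioms to three checkable facts:

* §1 the field `𝔽₂₅` in `ρ`-coordinates: the class of `(d₁ρ + d₂)(d′₁ρ + d′₂)` is `(d₁d′₂ + d₂d′₁ − d₁d′₁, d₂d′₂ − d₁d′₁)` (`ρ² = −ρ − 1`);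
  `1 − ρ ↔ (−1, 1)` generates `𝔽₂₅ˣ` with `(1 − ρ)⁸ = ρ`, `(1 − ρ)¹² = −1` (`gen_iterate_eight`, `gen_iterate_twelve`, by `decide`);
* §2 for `Φ` multiplicative in these coordinates (`hmul`) with `Φ(1 − ρ) = (−ρ²)^k`: `Φ(1) = 1` (`phi_one_eq_one`), `Φ(−1) = 1`
  (`phi_neg_one`), `Φ(ρ) = ρ^k` (`phi_rho`), hence ALL the axioms (`character_axioms_of_mul`);
* §3 the same from `ω`-coordinates `c ↔ c₁ + c₂ω₃`, `ω₃ = ρ + 1 = (1 + √−3)/2` (the coordinates of `QuadOrder.divPoint 3`): the change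
  `d = (c₂, c₁ + c₂)`, `c = (d₂ − d₁, d₁)` is multiplicative (`mul_of_omega_coords`), `1 − ρ ↔ c = (2, −1)`;
* §4 ★ `core_rho_of_mulChar` — the CM core for every `Φ` with `Φ 0 = 0`, `hmul`, `Φ(−1, 1) = (−ρ²)^k`, `1 ≤ k ≤ 5`; ★ `core_rho_of_mulChar_omega`
  — the same for a multiplicative weight `Ψ` in `ω`-coordinates with `Ψ 0 = 0`, `Ψ(2, −1) = (−ρ²)^k`, read through `Φ(d) = Ψ(d₂ − d₁, d₁)`.
For the sextic symbol `χ = (·/5)₆` (`χ(x) ≡ x⁴ mod 5ℤ[ρ]`): `χ(1 − ρ) = −ρ²` since `(1 − ρ)⁴ = 9ρ² ≡ −ρ²`, so `Φ = χ^e` has `k = e`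
(and `Φ = χ̄^e` has `k = 6 − e`). [cite: IrelandRosen1982, Ch. 9 §3 and Ch. 14 §2] [cite: Rubin1999, §7.4 Prop. 7.12]
-/

noncomputable section

open scoped Classical
open Complex PeriodPair
open Literature.NumberTheory.EllipticCurves

namespace Summit.BirchSwinnertonDyer.BirchSwinnertonDyer.Theorems.BiquadraticEisensteinDescentManinDatumSupercuspidalCMInertSexticCharacterAxiomsJZero

open Summit.BirchSwinnertonDyer.BirchSwinnertonDyer.Theorems.BiquadraticEisensteinDescentManinDatumSupercuspidalCMInertResolventCertificateJZero
  (core_rho_of_character)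

/-! ## §1 `𝔽₂₅ = 𝔽₅[ρ]` in `ρ`-coordinates -/

/-- `(1 − ρ)⁸ = ρ` in `𝔽₂₅`: eight multiplications by `1 − ρ ↔ (−1, 1)` send `1 ↔ (0, 1)` to `ρ ↔ (1, 0)`. [cite: IrelandRosen1982, Ch. 9 §3] -/
theorem gen_iterate_eight :
    (fun d' : ZMod 5 × ZMod 5 ↦ (((((-1, 1) : ZMod 5 × ZMod 5).1 * d'.2 + ((-1, 1) : ZMod 5 × ZMod 5).2 * d'.1 -
        ((-1, 1) : ZMod 5 × ZMod 5).1 * d'.1, ((-1, 1) : ZMod 5 × ZMod 5).2 * d'.2 - ((-1, 1) : ZMod 5 × ZMod 5).1 * d'.1)) :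
        ZMod 5 × ZMod 5))^[8] (0, 1) = (1, 0) := by
  decide

/-- `(1 − ρ)¹² = −1` in `𝔽₂₅`. [cite: IrelandRosen1982, Ch. 9 §3] -/
theorem gen_iterate_twelve :
    (fun d' : ZMod 5 × ZMod 5 ↦ (((((-1, 1) : ZMod 5 × ZMod 5).1 * d'.2 + ((-1, 1) : ZMod 5 × ZMod 5).2 * d'.1 -
        ((-1, 1) : ZMod 5 × ZMod 5).1 * d'.1, ((-1, 1) : ZMod 5 × ZMod 5).2 * d'.2 - ((-1, 1) : ZMod 5 × ZMod 5).1 * d'.1)) :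
        ZMod 5 × ZMod 5))^[12] (0, 1) = (0, -1) := by
  decide

/-- `ρ³ = 1` (from `ρ² = −ρ − 1`). [folklore] -/
private theorem rho_cube : (UpperHalfPlane.ρ : ℂ) ^ 3 = 1 := by
  have hr : (UpperHalfPlane.ρ : ℂ) ^ 2 = -(UpperHalfPlane.ρ : ℂ) - 1 := UpperHalfPlane.ρ_sq
  linear_combination ((UpperHalfPlane.ρ : ℂ) - 1) * hr

/-! ## §2 Multiplicative weights -/

section Mul

variable {k : ℕ} (Φ : ZMod 5 × ZMod 5 → ℂ)
  (hmul : ∀ d d' : ZMod 5 × ZMod 5, Φ (d.1 * d'.2 + d.2 * d'.1 - d.1 * d'.1, d.2 * d'.2 - d.1 * d'.1) = Φ d * Φ d')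
  (hgen : Φ (-1, 1) = (-(UpperHalfPlane.ρ : ℂ) ^ 2) ^ k)

include hmul

/-- Iterated multiplication by the generator: `Φ((1 − ρ)ⁿ·d) = Φ(1 − ρ)ⁿ·Φ(d)`. [cite: IrelandRosen1982, Ch. 9 §3] -/
theorem phi_gen_iterate (n : ℕ) (d : ZMod 5 × ZMod 5) :
    Φ ((fun d' : ZMod 5 × ZMod 5 ↦ (((((-1, 1) : ZMod 5 × ZMod 5).1 * d'.2 + ((-1, 1) : ZMod 5 × ZMod 5).2 * d'.1 -
        ((-1, 1) : ZMod 5 × ZMod 5).1 * d'.1, ((-1, 1) : ZMod 5 × ZMod 5).2 * d'.2 - ((-1, 1) : ZMod 5 × ZMod 5).1 * d'.1)) :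
        ZMod 5 × ZMod 5))^[n] d) = Φ (-1, 1) ^ n * Φ d := by
  induction n generalizing d with
  | zero => simp
  | succ n ih => rw [Function.iterate_succ', Function.comp_apply, hmul, ih]; ring

include hgen

/-- `Φ(1) = 1` (`Φ(1 − ρ) = Φ(1 − ρ)Φ(1)` and `Φ(1 − ρ) ≠ 0`). [cite: IrelandRosen1982, Ch. 9 §3] -/
theorem phi_one_eq_one : Φ (0, 1) = 1 := by
  have h := hmul (-1, 1) (0, 1)
  simp only [mul_one, mul_zero, add_zero, sub_zero] at h
  have hne : Φ (-1, 1) ≠ 0 := by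
    rw [hgen]; exact pow_ne_zero _ (neg_ne_zero.mpr (pow_ne_zero _ (UpperHalfPlane.ne_zero UpperHalfPlane.ρ)))
  have h0 : Φ (-1, 1) * (Φ (0, 1) - 1) = 0 := by linear_combination -h
  exact eq_of_sub_eq_zero ((mul_eq_zero.mp h0).resolve_left hne)

/-- `Φ(−1) = 1` (`−1 = (1 − ρ)¹²`, `(−ρ²)¹² = 1`). [cite: IrelandRosen1982, Ch. 9 §3] -/
theorem phi_neg_one : Φ (0, -1) = 1 := by
  have h := phi_gen_iterate Φ hmul 12 (0, 1)
  rw [gen_iterate_twelve, hgen, phi_one_eq_one Φ hmul hgen, mul_one] at h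
  rw [h, ← pow_mul, mul_comm, pow_mul]
  have h12 : (-(UpperHalfPlane.ρ : ℂ) ^ 2) ^ 12 = 1 := by
    calc (-(UpperHalfPlane.ρ : ℂ) ^ 2) ^ 12 = ((UpperHalfPlane.ρ : ℂ) ^ 3) ^ 8 := by ring
      _ = 1 := by rw [rho_cube, one_pow]
  rw [h12, one_pow]

/-- `Φ(ρ) = ρ^k` (`ρ = (1 − ρ)⁸`, `(−ρ²)⁸ = ρ`). [cite: IrelandRosen1982, Ch. 9 §3] -/
theorem phi_rho : Φ (1, 0) = (UpperHalfPlane.ρ : ℂ) ^ k := by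
  have h := phi_gen_iterate Φ hmul 8 (0, 1)
  rw [gen_iterate_eight, hgen, phi_one_eq_one Φ hmul hgen, mul_one] at h
  rw [h, ← pow_mul, mul_comm, pow_mul]
  congr 1
  calc (-(UpperHalfPlane.ρ : ℂ) ^ 2) ^ 8 = ((UpperHalfPlane.ρ : ℂ) ^ 3) ^ 5 * (UpperHalfPlane.ρ : ℂ) := by ring
    _ = (UpperHalfPlane.ρ : ℂ) := by rw [rho_cube, one_pow, one_mul]

/-- ★ **The five character axioms from multiplicativity**: a weight multiplicative in `ρ`-coordinates with `Φ(1 − ρ) = (−ρ²)^k`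
satisfies `Φ(1) = 1`, `Φ(−d) = Φ(d)`, `Φ(ρ·d) = ρ^kΦ(d)`, `Φ((1−ρ)·d) = (−ρ²)^kΦ(d)`. [cite: IrelandRosen1982, Ch. 9 §3 and Ch. 14 §2] -/
theorem character_axioms_of_mul :
    Φ (0, 1) = 1 ∧ (∀ d, Φ (-d) = Φ d) ∧
      (∀ d : ZMod 5 × ZMod 5, Φ (d.2 - d.1, -d.1) = (UpperHalfPlane.ρ : ℂ) ^ k * Φ d) ∧
      (∀ d : ZMod 5 × ZMod 5, Φ (2 * d.1 - d.2, d.1 + d.2) = (-(UpperHalfPlane.ρ : ℂ) ^ 2) ^ k * Φ d) := by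
  refine ⟨phi_one_eq_one Φ hmul hgen, fun d ↦ ?_, fun d ↦ ?_, fun d ↦ ?_⟩
  · have h := hmul (0, -1) d
    have e : ((((0, -1) : ZMod 5 × ZMod 5).1 * d.2 + ((0, -1) : ZMod 5 × ZMod 5).2 * d.1 - ((0, -1) : ZMod 5 × ZMod 5).1 * d.1,
        ((0, -1) : ZMod 5 × ZMod 5).2 * d.2 - ((0, -1) : ZMod 5 × ZMod 5).1 * d.1) : ZMod 5 × ZMod 5) = -d :=
      Prod.ext (by simp) (by simp)
    rw [e, phi_neg_one Φ hmul hgen, one_mul] at h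
    exact h
  · have h := hmul (1, 0) d
    have e : ((((1, 0) : ZMod 5 × ZMod 5).1 * d.2 + ((1, 0) : ZMod 5 × ZMod 5).2 * d.1 - ((1, 0) : ZMod 5 × ZMod 5).1 * d.1,
        ((1, 0) : ZMod 5 × ZMod 5).2 * d.2 - ((1, 0) : ZMod 5 × ZMod 5).1 * d.1) : ZMod 5 × ZMod 5) = (d.2 - d.1, -d.1) :=
      Prod.ext (by simp) (by simp)
    rw [e, phi_rho Φ hmul hgen] at h
    exact h
  · have h := hmul (-1, 1) d
    have e : ((((-1, 1) : ZMod 5 × ZMod 5).1 * d.2 + ((-1, 1) : ZMod 5 × ZMod 5).2 * d.1 - ((-1, 1) : ZMod 5 × ZMod 5).1 * d.1,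
        ((-1, 1) : ZMod 5 × ZMod 5).2 * d.2 - ((-1, 1) : ZMod 5 × ZMod 5).1 * d.1) : ZMod 5 × ZMod 5) = (2 * d.1 - d.2, d.1 + d.2) :=
      Prod.ext (by simp only []; ring) (by simp only []; ring)
    rw [e, hgen] at h
    exact h

end Mul

/-! ## §3 From `ω`-coordinates (`c ↔ c₁ + c₂ω₃`, `ω₃ = ρ + 1`) -/

/-- **The coordinate change is multiplicative**: for `Ψ` multiplicative in `ω`-coordinates (the class of `(c₁ + c₂ω)(c′₁ + c′₂ω)` is
`(c₁c′₁ − c₂c′₂, c₁c′₂ + c₂c′₁ + c₂c′₂)`, `ω² = ω − 1`), the weight `Φ(d) = Ψ(d₂ − d₁, d₁)` (`d₁ρ + d₂ = (d₂ − d₁) + d₁ω`) is multiplicative in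
`ρ`-coordinates. [cite: IrelandRosen1982, Ch. 9 §3] -/
theorem mul_of_omega_coords (Ψ : ZMod 5 × ZMod 5 → ℂ)
    (hΨ : ∀ c c' : ZMod 5 × ZMod 5, Ψ (c.1 * c'.1 - c.2 * c'.2, c.1 * c'.2 + c.2 * c'.1 + c.2 * c'.2) = Ψ c * Ψ c') :
    ∀ d d' : ZMod 5 × ZMod 5,
      (fun d : ZMod 5 × ZMod 5 ↦ Ψ (d.2 - d.1, d.1)) (d.1 * d'.2 + d.2 * d'.1 - d.1 * d'.1, d.2 * d'.2 - d.1 * d'.1) =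
        (fun d : ZMod 5 × ZMod 5 ↦ Ψ (d.2 - d.1, d.1)) d * (fun d : ZMod 5 × ZMod 5 ↦ Ψ (d.2 - d.1, d.1)) d' := by
  intro d d'
  simp only
  rw [← hΨ]
  congr 1
  exact Prod.ext (by simp only []; ring) (by simp only []; ring)

/-! ## §4 The CM core for multiplicative weights -/

/-- ★ **The CM core of the `j = 0` cell for a multiplicative weight.** For `1 ≤ k ≤ 5` and `Φ : (ℤ/5)² → ℂ` with `Φ 0 = 0`, multiplicative
in the `ρ`-coordinates `d ↔ d₁ρ + d₂` of `𝔽₂₅`, and `Φ(1 − ρ) = Φ(−1, 1) = (−ρ²)^k` (e.g. `Φ = (·/5)₆^k`): for every `M′` coprime to `5` and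
every `w` with `M′w ∈ ℤρ + ℤ` there is `s ∈ ℕ`, `5 ∤ s`, with `s·(Σ_d Φ(d)·E₁(w − (d₁ρ + d₂)/5; ℤρ + ℤ))/(ϖ₁·5^{(6−k)/6}) ∈ ℤ̄`.
[cite: Rubin1999, §7.4 Prop. 7.12] [cite: IrelandRosen1982, Ch. 9 §3 and Ch. 14 §2] -/
theorem core_rho_of_mulChar {k : ℕ} (hk1 : 1 ≤ k) (hk5 : k ≤ 5)
    (Φ : ZMod 5 × ZMod 5 → ℂ) (hΦ0 : Φ 0 = 0)
    (hmul : ∀ d d' : ZMod 5 × ZMod 5, Φ (d.1 * d'.2 + d.2 * d'.1 - d.1 * d'.1, d.2 * d'.2 - d.1 * d'.1) = Φ d * Φ d')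
    (hgen : Φ (-1, 1) = (-(UpperHalfPlane.ρ : ℂ) ^ 2) ^ k)
    (M' : ℕ) (hM5 : Nat.Coprime M' 5) (w : ℂ) (hMw : (M' : ℂ) * w ∈ (ofUpperHalfPlane UpperHalfPlane.ρ).lattice) :
    ∃ s : ℕ, ¬ 5 ∣ s ∧ IsIntegral ℤ ((s : ℂ) *
      (∑ d : ZMod 5 × ZMod 5, Φ d * (ofUpperHalfPlane UpperHalfPlane.ρ).eisensteinE₁
          (w - ((d.1.val : ℂ) * UpperHalfPlane.ρ + (d.2.val : ℂ)) / 5)) /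
        ((((2 : ℝ) ^ (2 / 3 : ℝ) * Real.Gamma (1 / 3) ^ 3 / (4 * Real.pi) : ℝ) : ℂ) * (5 : ℂ) ^ (((6 - k : ℕ) : ℂ) / 6))) := by
  obtain ⟨h1, hneg, hrho, hgen'⟩ := character_axioms_of_mul Φ hmul hgen
  exact core_rho_of_character hk1 hk5 Φ hΦ0 h1 hneg hrho hgen' M' hM5 w hMw

/-- ★ **The CM core of the `j = 0` cell for a multiplicative weight in `ω`-coordinates** (`c ↔ c₁ + c₂ω₃`, the coordinates of
`QuadOrder.divPoint 3`): for `Ψ : (ℤ/5)² → ℂ` with `Ψ 0 = 0`, multiplicative for `(c₁ + c₂ω)(c′₁ + c′₂ω)`, and `Ψ(1 − ρ) = Ψ(2, −1) = (−ρ²)^k`,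
the core holds for the weight `Φ(d) = Ψ(d₂ − d₁, d₁)` at the points `(d₁ρ + d₂)/5 = ((d₂ − d₁) + d₁ω)/5`.
[cite: Rubin1999, §7.4 Prop. 7.12] [cite: IrelandRosen1982, Ch. 9 §3 and Ch. 14 §2] -/
theorem core_rho_of_mulChar_omega {k : ℕ} (hk1 : 1 ≤ k) (hk5 : k ≤ 5)
    (Ψ : ZMod 5 × ZMod 5 → ℂ) (hΨ0 : Ψ 0 = 0)
    (hΨ : ∀ c c' : ZMod 5 × ZMod 5, Ψ (c.1 * c'.1 - c.2 * c'.2, c.1 * c'.2 + c.2 * c'.1 + c.2 * c'.2) = Ψ c * Ψ c')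
    (hgen : Ψ (2, -1) = (-(UpperHalfPlane.ρ : ℂ) ^ 2) ^ k)
    (M' : ℕ) (hM5 : Nat.Coprime M' 5) (w : ℂ) (hMw : (M' : ℂ) * w ∈ (ofUpperHalfPlane UpperHalfPlane.ρ).lattice) :
    ∃ s : ℕ, ¬ 5 ∣ s ∧ IsIntegral ℤ ((s : ℂ) *
      (∑ d : ZMod 5 × ZMod 5, Ψ (d.2 - d.1, d.1) * (ofUpperHalfPlane UpperHalfPlane.ρ).eisensteinE₁
          (w - ((d.1.val : ℂ) * UpperHalfPlane.ρ + (d.2.val : ℂ)) / 5)) /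
        ((((2 : ℝ) ^ (2 / 3 : ℝ) * Real.Gamma (1 / 3) ^ 3 / (4 * Real.pi) : ℝ) : ℂ) * (5 : ℂ) ^ (((6 - k : ℕ) : ℂ) / 6))) := by
  have hmul := mul_of_omega_coords Ψ hΨ
  simp only at hmul
  refine core_rho_of_mulChar hk1 hk5 (fun d : ZMod 5 × ZMod 5 ↦ Ψ (d.2 - d.1, d.1)) ?_ hmul ?_ M' hM5 w hMw
  · show Ψ ((0 : ZMod 5 × ZMod 5).2 - (0 : ZMod 5 × ZMod 5).1, (0 : ZMod 5 × ZMod 5).1) = 0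
    rw [show (((0 : ZMod 5 × ZMod 5).2 - (0 : ZMod 5 × ZMod 5).1, (0 : ZMod 5 × ZMod 5).1) : ZMod 5 × ZMod 5) = 0 from by decide]
    exact hΨ0
  · show Ψ ((1 : ZMod 5) - -1, -1) = _
    rw [show (((1 : ZMod 5) - -1, -1) : ZMod 5 × ZMod 5) = (2, -1) from Prod.ext (by ring) rfl]
    exact hgen

end Summit.BirchSwinnertonDyer.BirchSwinnertonDyer.Theorems.BiquadraticEisensteinDescentManinDatumSupercuspidalCMInertSexticCharacterAxiomsJZero

end
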